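import Literature.MathematicalPhysics.QuantumFieldTheory.Balaban1983to89.Beta.RemainderChain
import Summits.QuantumFields.BalabanUV.Beta.EriceRemainderEnclosureHistoryAutonomyFunctionalShiftEnd

/-!
# EriceRemainderEnclosureHistoryAutonomyFunctionalShiftRemainderConst — (E51f) WHAT ROW D4's LEAF `RemainderConst` FIXES ABOUT THE CONTINUUM RUNNING
# COUPLING: read the printed one-loop split `β = β⁰ + β¹` (`B12Beta.OneLoopSplit`) with `RemainderConst S γ r` (`|β¹_{k+1}| ≤ r` on ]0,γ]^{k+1}`) as
# `r`-CLOSENESS of `β` to its history-independent one-loop truncation `(k, v) ↦ β⁰_{k+1}` on every sub-box; then, under node U2's binder list for `β` in the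
# simplified sharp regime and an eventual floor `b + r ≤ β⁰_{k+1}` with geometric convergence of the `β⁰`'s, the continuum running couplings `g⋆` (full) and
# `g⁰⋆` (one-loop truncation) of any two lattice families pinned at one `g_IR` satisfy `|1∕(g⋆_m)² − 1∕(g⁰⋆_m)²| ≤ 2e^{6M∕(b√b)}·m·r` — order `m·r`, NOT
# improvable from `RemainderConst` alone ((E51c) `disc_const_excess`) — and `|g⋆_m − g⁰⋆_m| ≤ (2e^{6M∕(b√b)}+1)∕(b√b)·r∕√m`: the leaf pins the one-loop RATE
# of the levels only within `±O(r)` but forces the couplings to merge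

Cell `pub-balaban`, β-function sub-cell, BINDER row D4 «RemainderConst leaves for Bałaban's split» (`HOME/BINDER-OWNERS.md`; owner lineage `b2b-balaban-beta-an4`;
this file by co-owner #2 lineage `b2b-balaban-beta-d4-p2`, generation 47), β-FLOW TEAM duty (1), FREEZE (0) honoured (def-free: the truncation is the lambda
term `fun k _ => S.β0 k`; an4's `Beta.RemainderChain.RemainderConst` and `B12Beta.OneLoopSplit`, node U2's shapes, (E51d)'s `abs_invSq_gstar_sub_le` ∕
`abs_gstar_sub_gstar_le_decay` BY NAME, nothing restated).  Sequel of (E51d) `…FunctionalShiftEnd`; a module of the lineage's E-series that CONSUMES row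
D4's leaf predicate by name on the continuum-coupling side (the Erice-enclosure modules consume it on the holomorphy side).

HONEST FRAMING (page 1, verbatim and binding).  *"Discharging BetaPertH makes Bałaban's UV stability UNCONDITIONAL — a real constructive-QFT result; it is
NOT the continuum limit and NOT the Clay problem."*  THIS FILE DISCHARGES NOTHING OF THE KIND.  `RemainderConst S γ r` enters as a HYPOTHESIS on an
ABSTRACT split `S : B12Beta.OneLoopSplit β` — for Bałaban's split it is row D4's OPEN discharge (instance 0∕1); the floor and the geometric convergence of
the one-loop coefficients are the CAP-k ∕ asym rows' business and enter as hypotheses; node U2's binders are NOT PRINTED (GAPS G-t4-U2-1∕-2).  Row D4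
class UNCHANGED (critical-path width 0; instance 0∕1; D4 DISCHARGE NO DATE).  HONEST DEPENDENCY: continuum YM on T⁴ ⇐ BetaPertH ∧ nine spine estimates
(0/9 proved); BetaPertH ⇐ (D1) ∧ (D4) ∧ CAP+tail; G-an2-4 gates asym, D1 and NE2/3/4.

WHAT IS PROVED ([folklore]; 0 `def`, 0 sorry).  §1 **`close_of_remainderConst`** (`RemainderConst` ⟹ (E51d)'s sub-box closeness `hlat` with `ρ ≡ r`),
`close_of_remainderConst_box`, `histLipschitz_trunc` (`HistLipschitz 0` for the truncation), `scaleShiftRate_trunc`, `eventualLowerH_trunc`,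
**`eventualLowerH_full`** (`b + r ≤ β⁰` and `RemainderConst` ⟹ `EventualLowerH b` for `β`).  §2 **`abs_invSq_gstar_sub_le_of_remainderConst`**
(`|1∕(g⋆_m)² − 1∕(g⁰⋆_m)²| ≤ 2e^{6M∕(b√b)}·m·r`), **`abs_gstar_sub_gstar_le_of_remainderConst`** (`|g⋆_m − g⁰⋆_m| ≤ (2e^{6M∕(b√b)}+1)∕(b√b)·r∕√m`, `m ≥ 1`).
-/

noncomputable section
open Filter Topology Finset

namespace Summit.QuantumFields.BalabanUV.Beta.EriceRemainderEnclosureHistoryAutonomyFunctionalShiftRemainderConst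

open Literature.MathematicalPhysics.QuantumFieldTheory.Balaban1983to89
open Literature.MathematicalPhysics.QuantumFieldTheory.Balaban1983to89.FlowStep
open Literature.MathematicalPhysics.QuantumFieldTheory.Balaban1983to89.T4CouplingMatching
open Literature.MathematicalPhysics.QuantumFieldTheory.Balaban1983to89.T4CauchySum (InjectedRate)
open Literature.MathematicalPhysics.QuantumFieldTheory.Balaban1983to89.T4ContinuumCoupling
open Literature.MathematicalPhysics.QuantumFieldTheory.Balaban1983to89.T4BetaStationary
open Literature.MathematicalPhysics.QuantumFieldTheory.Balaban1983to89.Beta.RemainderChain (RemainderConst)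
open Summit.QuantumFields.BalabanUV.Beta.EriceRemainderEnclosureHistoryAutonomyFunctionalShiftEnd

variable {β : HBeta} {γ c θs ct θst : ℝ} {Λ : ℕ → ℕ → ℝ} {M r : ℝ}
variable {g gt : ℕ → ℕ → ℝ} {gIR C θ₁ Ct θt b : ℝ} {k₀ : ℕ}

/-! ## §1 The one-loop truncation as a second history family; `RemainderConst` as sub-box closeness -/

/-- **`RemainderConst` IS SUB-BOX CLOSENESS TO THE ONE-LOOP TRUNCATION**: `|β¹_{k+1}| ≤ r` on ]0,γ]^{k+1} (row D4's leaf `RemainderConst S γ r`) says that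
`β` and its history-independent one-loop truncation `(k, v) ↦ β⁰_{k+1}` are `r`-close on every sub-box ]0,a]^{k+1}, `a ≤ γ` — the hypothesis `hlat` of (E51d)
with the constant profile `ρ ≡ r`. [folklore] -/
theorem close_of_remainderConst (S : B12Beta.OneLoopSplit β) (hR : RemainderConst S γ r) :
    ∀ a : ℝ, 0 < a → a ≤ γ → ∀ k v, v ∈ Box a k → |β k v - (fun (k : ℕ) (_ : Fin (k + 1) → ℝ) => S.β0 k) k v| ≤ (fun _ : ℝ => r) a := by
  intro a _ haγ k v hv
  have hv' : v ∈ B12Beta.HistBox γ k := fun i => ⟨((mem_box.1 hv) i).1, ((mem_box.1 hv) i).2.trans haγ⟩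
  have e : β k v - S.β0 k = S.β1 k v := by rw [S.split k v]; ring
  simp only [e]
  exact hR k v hv'

/-- … in particular `r`-close on the full box (the hypothesis `hclose` of (E51d)'s coupling END). [folklore] -/
theorem close_of_remainderConst_box (S : B12Beta.OneLoopSplit β) (hR : RemainderConst S γ r) :
    ∀ k v, v ∈ Box γ k → |β k v - (fun (k : ℕ) (_ : Fin (k + 1) → ℝ) => S.β0 k) k v| ≤ r := by
  intro k v hv
  have e : β k v - S.β0 k = S.β1 k v := by rw [S.split k v]; ring
  simp only [e]
  exact hR k v fun i => (mem_box.1 hv) i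

/-- The one-loop truncation has NO memory: `HistLipschitz 0`. [folklore] -/
theorem histLipschitz_trunc (S : B12Beta.OneLoopSplit β) :
    HistLipschitz (fun _ _ => 0) γ (fun (k : ℕ) (_ : Fin (k + 1) → ℝ) => S.β0 k) := by
  intro k p q _ _
  simp

/-- Geometric convergence of the one-loop coefficients IS `ScaleShiftRate` for the truncation. [folklore] -/
theorem scaleShiftRate_trunc (S : B12Beta.OneLoopSplit β) (hrate : ∀ k, |S.β0 (k + 1) - S.β0 k| ≤ ct * θst ^ k) :
    ScaleShiftRate ct θst γ (fun (k : ℕ) (_ : Fin (k + 1) → ℝ) => S.β0 k) := fun k _ _ => hrate k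

/-- An eventual floor `b ≤ β⁰_{k+1}` IS `EventualLowerH b` for the truncation. [folklore] -/
theorem eventualLowerH_trunc (S : B12Beta.OneLoopSplit β) (hlo : ∀ k, k₀ ≤ k → b ≤ S.β0 k) :
    EventualLowerH b γ k₀ (fun (k : ℕ) (_ : Fin (k + 1) → ℝ) => S.β0 k) := fun k _ hk _ => hlo k hk

/-- An eventual floor `b + r ≤ β⁰_{k+1}` together with `RemainderConst S γ r` gives the eventual floor `b` for the FULL family. [folklore] -/
theorem eventualLowerH_full (S : B12Beta.OneLoopSplit β) (hR : RemainderConst S γ r) (hlo : ∀ k, k₀ ≤ k → b + r ≤ S.β0 k) :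
    EventualLowerH b γ k₀ β := by
  intro k v hk hv
  have h1 := hR k v fun i => (mem_box.1 hv) i
  rw [S.split k v]
  linarith [hlo k hk, (abs_le.1 h1).1]

/-! ## §2 The ENDs: what `RemainderConst` fixes about the continuum running coupling -/

/-- **A `RemainderConst` LEAF CONTROLS THE LEVELS OF THE CONTINUUM RUNNING COUPLING UP TO `O(m·r)`.**  `β = β⁰ + β¹` (the printed one-loop split
`B12Beta.OneLoopSplit`) with row D4's leaf `RemainderConst S γ r` (`|β¹_{k+1}| ≤ r` on ]0,γ]^{k+1}); the one-loop coefficients with an eventual floor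
`b + r ≤ β⁰_{k+1}` (`k ≥ k₀`, `b > 0`) and geometric convergence `|β⁰_{k+2} − β⁰_{k+1}| ≤ ct·θst^k`; the full family under node U2's binder list
(`ScaleShiftRate c θs γ β`, `HistLipschitz Λ γ β` with `Λ ≥ 0` and rows `≤ M`) in the simplified sharp regime `M·γ ≤ (3√3∕2)·b`, `M·γ³ ≤ 1∕2`; lattice families
`g` (runs of `β`) and `gt` (runs of the truncation `β⁰`), `InjectedRate` each, in the box, BOTH pinned at `g_IR`.  Then at EVERY physical scale
`|1∕(g⋆_m)² − 1∕(g⁰⋆_m)²| ≤ 2e^{6M∕(b√b)}·m·r` — and by (E51c) `disc_const_excess` the order `m·r` cannot be improved from `RemainderConst` alone.  Binders NOT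
PRINTED, never facts; `RemainderConst` for Bałaban's split is row D4's OPEN discharge. [folklore] -/
theorem abs_invSq_gstar_sub_le_of_remainderConst (S : B12Beta.OneLoopSplit β) (hR : RemainderConst S γ r)
    (hθ1 : θ₁ < 1) (hinj : InjectedRate C 0 θ₁ (fun K j => disc (g K) (g (K + 1)) j))
    (hbox : ∀ K i, i ≤ K → 0 < g K i ∧ g K i ≤ γ) (hrun : ∀ K, RGEqH K β (g K)) (hpin : ∀ K, g K K = gIR)
    (hθt1 : θt < 1) (hinjt : InjectedRate Ct 0 θt (fun K j => disc (gt K) (gt (K + 1)) j))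
    (hboxt : ∀ K i, i ≤ K → 0 < gt K i ∧ gt K i ≤ γ)
    (hrunt : ∀ K, RGEqH K (fun (k : ℕ) (_ : Fin (k + 1) → ℝ) => S.β0 k) (gt K)) (hpint : ∀ K, gt K K = gIR)
    (hss : ScaleShiftRate c θs γ β) (hL : HistLipschitz Λ γ β) (hΛ : ∀ k i, i ≤ k → 0 ≤ Λ k i)
    (hrow : ∀ k, ∑ i ∈ range (k + 1), Λ k i ≤ M) (hθs0 : 0 ≤ θs) (hθs1 : θs < 1)
    (hb : 0 < b) (hq : M * γ ≤ 3 * Real.sqrt 3 * b / 2) (hK : M * γ ^ 3 ≤ 1 / 2)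
    (hlo0 : ∀ k, k₀ ≤ k → b + r ≤ S.β0 k) (hrate : ∀ k, |S.β0 (k + 1) - S.β0 k| ≤ ct * θst ^ k) (hθst0 : 0 ≤ θst)
    (hθst1 : θst < 1) (m : ℕ) :
    |1 / gstar g m ^ 2 - 1 / gstar gt m ^ 2| ≤ 2 * Real.exp (6 * M / (b * Real.sqrt b)) * ((m : ℝ) * r) := by
  have hlo0' : ∀ k, k₀ ≤ k → b ≤ S.β0 k := fun k hk => by
    have hγ : 0 < γ := (hbox 0 0 le_rfl).1.trans_le (hbox 0 0 le_rfl).2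
    have hr0 : 0 ≤ r := (abs_nonneg _).trans (hR 0 (fun _ => γ) fun _ => ⟨hγ, le_rfl⟩)
    linarith [hlo0 k hk]
  have h1 := abs_invSq_gstar_sub_le (ρ := fun _ : ℝ => r) hθ1 hinj hbox hrun hpin hθt1 hinjt hboxt hrunt hpint hss hL hΛ hrow hθs0
    hθs1 (eventualLowerH_full S hR hlo0) hb hq hK (scaleShiftRate_trunc S hrate) (histLipschitz_trunc S) hθst0 hθst1
    (eventualLowerH_trunc S hlo0') (close_of_remainderConst S hR) m
  simpa only [sum_const, card_range, nsmul_eq_mul] using h1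

/-- **… WHILE THE CONTINUUM COUPLINGS THEMSELVES MERGE LIKE `r∕√m`**: under the same binders, for `m ≥ 1`,
`|g⋆_m − g⁰⋆_m| ≤ (2e^{6M∕(b√b)} + 1)∕(b√b) · r∕√m`. [folklore] -/
theorem abs_gstar_sub_gstar_le_of_remainderConst (S : B12Beta.OneLoopSplit β) (hR : RemainderConst S γ r)
    (hθ1 : θ₁ < 1) (hinj : InjectedRate C 0 θ₁ (fun K j => disc (g K) (g (K + 1)) j))
    (hbox : ∀ K i, i ≤ K → 0 < g K i ∧ g K i ≤ γ) (hrun : ∀ K, RGEqH K β (g K)) (hpin : ∀ K, g K K = gIR)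
    (hθt1 : θt < 1) (hinjt : InjectedRate Ct 0 θt (fun K j => disc (gt K) (gt (K + 1)) j))
    (hboxt : ∀ K i, i ≤ K → 0 < gt K i ∧ gt K i ≤ γ)
    (hrunt : ∀ K, RGEqH K (fun (k : ℕ) (_ : Fin (k + 1) → ℝ) => S.β0 k) (gt K)) (hpint : ∀ K, gt K K = gIR)
    (hss : ScaleShiftRate c θs γ β) (hL : HistLipschitz Λ γ β) (hΛ : ∀ k i, i ≤ k → 0 ≤ Λ k i)
    (hrow : ∀ k, ∑ i ∈ range (k + 1), Λ k i ≤ M) (hθs0 : 0 ≤ θs) (hθs1 : θs < 1)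
    (hb : 0 < b) (hq : M * γ ≤ 3 * Real.sqrt 3 * b / 2) (hK : M * γ ^ 3 ≤ 1 / 2)
    (hlo0 : ∀ k, k₀ ≤ k → b + r ≤ S.β0 k) (hrate : ∀ k, |S.β0 (k + 1) - S.β0 k| ≤ ct * θst ^ k) (hθst0 : 0 ≤ θst)
    (hθst1 : θst < 1) {m : ℕ} (hm : 1 ≤ m) :
    |gstar g m - gstar gt m| ≤ (2 * Real.exp (6 * M / (b * Real.sqrt b)) + 1) / (b * Real.sqrt b) * (r / Real.sqrt (m : ℝ)) := by
  have hlo0' : ∀ k, k₀ ≤ k → b ≤ S.β0 k := fun k hk => by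
    have hγ : 0 < γ := (hbox 0 0 le_rfl).1.trans_le (hbox 0 0 le_rfl).2
    have hr0 : 0 ≤ r := (abs_nonneg _).trans (hR 0 (fun _ => γ) fun _ => ⟨hγ, le_rfl⟩)
    linarith [hlo0 k hk]
  exact abs_gstar_sub_gstar_le_decay hθ1 hinj hbox hrun hpin hθt1 hinjt hboxt hrunt hpint hss hL hΛ hrow hθs0 hθs1
    (eventualLowerH_full S hR hlo0) hb hq hK (scaleShiftRate_trunc S hrate) (histLipschitz_trunc S) hθst0 hθst1
    (eventualLowerH_trunc S hlo0') (close_of_remainderConst_box S hR) hm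

end Summit.QuantumFields.BalabanUV.Beta.EriceRemainderEnclosureHistoryAutonomyFunctionalShiftRemainderConst

end
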